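import Summits.QuantumAdvantage.QuantumAdvantage.Theses.SpinorFlattening
import Literature.Computability.QuantumComplexity.BQPSubsetPP
import Literature.Computability.QuantumComplexity.ClassicalClassesProofs
import Literature.Computability.Complexity.CircuitClassesUniformProofs

/-!
# Crux `SpinorFlattening.GaussRankPolyImpliesPPoly` (stmt-QuantumAdvantage-1247) — negative lemmas: the shape of any refutation

Disprover's support file (refuter-cdisprove-stmt-QuantumAdvantage-1247-0, 2026-08-16; work file
`Cruxes/GaussRankPolyImpliesPPoly/Disproof.lean`). The crux is the implication
`GaussRankPolyThesis → BQP ⊆ PPoly` (route target `X` ⇒ non-uniform dequantization). This file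
records, as kernel-checked NEGATIVE lemmas, why it cannot be refuted cheaply and how it is settled:

* `GaussRankPolyThesis_false_of_negApprox` — the route's kill item `NegApproxGaussRankSuperpoly`
  (stmt-1245) refutes the target `X` (stmt-1244): the designed kill wiring, by name;
* `not_not_GaussRankPolyImpliesPPoly_of_negApprox` — hence, given the kill item, the crux is
  irrefutable (it then holds ex falso); `not_negApprox_of_not_GaussRankPolyImpliesPPoly` — a
  refutation of the crux would refute the kill item;
* `not_BQP_subset_PPoly_of_not_GaussRankPolyImpliesPPoly`, `not_PP_subset_PPoly_of_…`,
  `not_PSPACE_subset_PPoly_of_…`, `P_ne_PSPACE_of_…` — a refutation of the crux proves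
  `BQP ⊄ P/poly`, hence (through the DISCHARGED tree theorems `BQP_subset_PP_holds`,
  `PP_subset_PSPACE_holds`, `P_subset_PPoly_holds`) `PP ⊄ P/poly`, `PSPACE ⊄ P/poly` and
  `P ≠ PSPACE` — frontier-open circuit lower bounds (natural-proofs barred under hard PRGs:
  `Literature.Barriers.QuantumAdvantage.NaturalProofs`);
* `not_coefReductionSchema` — the dictionary-free "coefficient reduction" schema that a NON-vacuous
  `P/poly` packaging of `X` would like to invoke (few-term representability ⇒ few-term approximate
  representability with uniformly BOUNDED coefficients) is false already in `ℂ² = QReg 1 → ℂ`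
  (dictionary `{e₀, e₀ + ε e₁}`, target `e₁`): any such lemma for the Gaussian dictionary must use
  the geometry of the spinor variety. (Bit-size gap: DiasKoenig2024 §2.5 counts arithmetic
  operations and §4.1 takes the decomposition as input; `X` bounds only the number of terms.)
-/

set_option linter.dupNamespace false

noncomputable section

namespace Summit.QuantumAdvantage.QuantumAdvantage.Theorems.GaussRankPolyImpliesPPoly.Negative

open Literature.Computability.Complexity Literature.Computability.Complexity.Classes
open Literature.Computability.Cryptography Literature.Computability.QuantumComplexity
open Summit.QuantumAdvantage.QuantumAdvantage.Theses.SpinorFlattening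

/-! ### Kill wiring -/

/-- **The kill item refutes the target**: `NegApproxGaussRankSuperpoly → ¬ GaussRankPolyThesis`
(the three inline `let`s of the two items are syntactically identical). [folklore] -/
theorem GaussRankPolyThesis_false_of_negApprox (h : NegApproxGaussRankSuperpoly) :
    ¬ GaussRankPolyThesis := by
  intro hX
  obtain ⟨δ, hδ0, -, hall⟩ := h
  obtain ⟨c, hc⟩ := hX δ hδ0
  obtain ⟨t, ht⟩ := hall c
  obtain ⟨r, hr, a, g, hg, hle⟩ := hc t
  exact absurd hle (not_le.2 (ht r hr a g hg))

/-- **Given the kill item, the crux `GaussRankPolyImpliesPPoly` is irrefutable** (it holds ex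
falso: `fun hX => absurd hX (GaussRankPolyThesis_false_of_negApprox h)`). [folklore] -/
theorem not_not_GaussRankPolyImpliesPPoly_of_negApprox (h : NegApproxGaussRankSuperpoly) :
    ¬ ¬ GaussRankPolyImpliesPPoly :=
  fun hn => hn fun hX => absurd hX (GaussRankPolyThesis_false_of_negApprox h)

/-- A refutation of the crux would refute the kill item. [folklore] -/
theorem not_negApprox_of_not_GaussRankPolyImpliesPPoly (h : ¬ GaussRankPolyImpliesPPoly) :
    ¬ NegApproxGaussRankSuperpoly :=
  fun hk => not_not_GaussRankPolyImpliesPPoly_of_negApprox hk h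

/-- A refutation of the crux cannot coexist with a refutation of the target `X` (it needs `X`).
[folklore] -/
theorem not_not_GaussRankPolyThesis_of_not_GaussRankPolyImpliesPPoly
    (h : ¬ GaussRankPolyImpliesPPoly) : ¬ ¬ GaussRankPolyThesis :=
  fun hX => h fun hX' => absurd hX' hX

/-! ### What a refutation would prove in classical complexity -/

/-- A refutation of the crux separates `BQP` from `P/poly` (the thesis of the closed route
`CircuitLB`). [folklore] -/
theorem not_BQP_subset_PPoly_of_not_GaussRankPolyImpliesPPoly (h : ¬ GaussRankPolyImpliesPPoly) :
    ¬ (BQP ⊆ PPoly) :=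
  fun hincl => h fun _ => hincl

/-- **… hence `PP ⊄ P/poly`** (discharged tree theorem `BQP ⊆ PP`, Adleman–DeMarrais–Huang).
[cite: AdlemanDeMarraisHuang1997, Thm. 6.4] -/
theorem not_PP_subset_PPoly_of_not_GaussRankPolyImpliesPPoly (h : ¬ GaussRankPolyImpliesPPoly) :
    ¬ (PP ⊆ PPoly) :=
  fun hPP => not_BQP_subset_PPoly_of_not_GaussRankPolyImpliesPPoly h
    (fun _ hL => hPP (BQP_subset_PP_holds hL))

/-- **… hence `PSPACE ⊄ P/poly`** (discharged `PP ⊆ PSPACE`, Gill). Open; frontier `MA_EXP ⊄ P/poly`.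
[cite: AroraBarak2009, §6.1] -/
theorem not_PSPACE_subset_PPoly_of_not_GaussRankPolyImpliesPPoly (h : ¬ GaussRankPolyImpliesPPoly) :
    ¬ (PSPACE ⊆ PPoly) :=
  fun hPS => not_PP_subset_PPoly_of_not_GaussRankPolyImpliesPPoly h
    (fun _ hL => hPS (PP_subset_PSPACE_holds hL))

/-- **… hence `P ≠ PSPACE`** (discharged `P ⊆ P/poly`). [cite: AroraBarak2009, Thm. 6.6] -/
theorem P_ne_PSPACE_of_not_GaussRankPolyImpliesPPoly (h : ¬ GaussRankPolyImpliesPPoly) :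
    P ≠ PSPACE := by
  intro hP
  apply not_PSPACE_subset_PPoly_of_not_GaussRankPolyImpliesPPoly h
  rw [← hP]
  exact P_subset_PPoly_holds

/-! ### The dictionary-free coefficient-reduction schema is false -/

/-- One squared amplitude is dominated by `normSq`. [folklore] -/
theorem norm_sq_apply_le_normSq {n : ℕ} (f : QReg n → ℂ) (x : QReg n) : ‖f x‖ ^ 2 ≤ normSq f :=
  Finset.single_le_sum (f := fun y => ‖f y‖ ^ 2) (fun _ _ => by positivity) (Finset.mem_univ x)

/-- **No dictionary-free coefficient reduction**: there are NO uniform `N, B` such that, for every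
dictionary `D` of vectors of `normSq ≤ 2` in `ℂ² = QReg 1 → ℂ` and every unit `ψ`, exact 2-term
`D`-representability of `ψ` implies `(1/4)`-approximate `D`-representability (`normSq ≤ 1/16`) with
`≤ N` terms and coefficients of norm `≤ B`. Witness: `D = {e₀, e₀ + ε e₁}`, `ψ = e₁`,
`ε = 1/(2(N+1)·max B 1)`: every bounded combination has amplitude `≤ 1/2` on `e₁`. [folklore] -/
theorem not_coefReductionSchema :
    ¬ ∃ (N : ℕ) (B : ℝ), ∀ (D : (QReg 1 → ℂ) → Prop) (ψ : QReg 1 → ℂ),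
      normSq ψ = 1 → (∀ d, D d → normSq d ≤ 2) →
      (∃ (a : Fin 2 → ℂ) (g : Fin 2 → QReg 1 → ℂ), (∀ i, D (g i)) ∧ ψ = ∑ i, a i • g i) →
      ∃ (r : ℕ) (a : Fin r → ℂ) (g : Fin r → QReg 1 → ℂ), r ≤ N ∧ (∀ i, D (g i)) ∧
        (∀ i, ‖a i‖ ≤ B) ∧ normSq (ψ - ∑ i, a i • g i) ≤ 1 / 16 := by
  rintro ⟨N, B, h⟩
  let x0 : QReg 1 := fun _ => false
  let x1 : QReg 1 := fun _ => true
  have hx : x1 ≠ x0 := fun hx => Bool.noConfusion (congrFun hx 0)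
  let e0 : QReg 1 → ℂ := basisState x0
  let e1 : QReg 1 → ℂ := basisState x1
  let B' : ℝ := max B 1
  have hBB' : B ≤ B' := le_max_left _ _
  let ε : ℝ := 1 / (2 * ((N : ℝ) + 1) * B')
  have hε0 : 0 < ε := by positivity
  let v : QReg 1 → ℂ := e0 + (ε : ℂ) • e1
  let D : (QReg 1 → ℂ) → Prop := fun d => d = e0 ∨ d = v
  have he0x1 : e0 x1 = 0 := by simp [e0, basisState_apply, hx]
  have he1x1 : e1 x1 = 1 := by simp [e1, basisState_apply]
  have hvx1 : v x1 = ε := by simp [v, he0x1, he1x1]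
  have hψ : normSq e1 = 1 := normSq_basisState x1
  have hD : ∀ d, D d → normSq d ≤ 2 := by
    rintro d (rfl | rfl)
    · rw [normSq_basisState]; norm_num
    · have hsplit : normSq v = ‖v x0‖ ^ 2 + ‖v x1‖ ^ 2 := by
        rw [normSq, Fintype.sum_eq_add x0 x1 hx.symm]
        rintro y ⟨hy0, hy1⟩
        exfalso
        rcases Bool.eq_false_or_eq_true (y 0) with hy | hy
        · exact hy1 (funext fun i => by rw [Subsingleton.elim i 0, hy])
        · exact hy0 (funext fun i => by rw [Subsingleton.elim i 0, hy])
      have hvx0 : v x0 = 1 := by simp [v, e0, e1, basisState_apply, hx.symm]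
      have hε1 : ε ≤ 1 := by
        rw [div_le_one (by positivity)]
        nlinarith [(Nat.cast_nonneg N : (0 : ℝ) ≤ N), (le_max_right B 1 : (1 : ℝ) ≤ B')]
      rw [hsplit, hvx0, hvx1, norm_one, Complex.norm_real, Real.norm_eq_abs, abs_of_pos hε0]
      nlinarith
  have hexact : ∃ (a : Fin 2 → ℂ) (g : Fin 2 → QReg 1 → ℂ), (∀ i, D (g i)) ∧ e1 = ∑ i, a i • g i := by
    refine ⟨![(ε : ℂ)⁻¹, -(ε : ℂ)⁻¹], ![v, e0], ?_, ?_⟩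
    · intro i
      fin_cases i
      · exact Or.inr rfl
      · exact Or.inl rfl
    · have hεc : (ε : ℂ) ≠ 0 := Complex.ofReal_ne_zero.2 hε0.ne'
      rw [Fin.sum_univ_two]
      simp only [Matrix.cons_val_zero, Matrix.cons_val_one]
      rw [show v = e0 + (ε : ℂ) • e1 from rfl, smul_add, smul_smul, inv_mul_cancel₀ hεc, one_smul,
        neg_smul]
      abel
  obtain ⟨r, a, g, hr, hg, ha, herr⟩ := h D e1 hψ hD hexact
  have hgx1 : ∀ i, ‖g i x1‖ ≤ ε := by
    intro i
    rcases hg i with hgi | hgi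
    · rw [hgi, he0x1, norm_zero]; exact hε0.le
    · rw [hgi, hvx1, Complex.norm_real, Real.norm_eq_abs, abs_of_pos hε0]
  have hsum : ‖(∑ i, a i • g i) x1‖ ≤ 1 / 2 := by
    calc ‖(∑ i, a i • g i) x1‖ = ‖∑ i, a i * g i x1‖ := by simp [Finset.sum_apply]
      _ ≤ ∑ i, ‖a i * g i x1‖ := norm_sum_le _ _
      _ ≤ ∑ _i : Fin r, B' * ε := Finset.sum_le_sum fun i _ => by
          rw [norm_mul]
          exact mul_le_mul ((ha i).trans hBB') (hgx1 i) (norm_nonneg _) (by positivity)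
      _ = r * (B' * ε) := by rw [Finset.sum_const, Finset.card_univ, Fintype.card_fin, nsmul_eq_mul]
      _ ≤ N * (B' * ε) := by gcongr
      _ = N / (2 * (N + 1)) := by
          have hB'0 : (0 : ℝ) < B' := lt_of_lt_of_le one_pos (le_max_right B 1)
          simp only [ε]
          field_simp
      _ ≤ 1 / 2 := by
          rw [div_le_div_iff₀ (by positivity) (by positivity)]
          nlinarith [(Nat.cast_nonneg N : (0 : ℝ) ≤ N)]
  have hpt : (1 / 2 : ℝ) ^ 2 ≤ normSq (e1 - ∑ i, a i • g i) := by
    refine le_trans ?_ (norm_sq_apply_le_normSq _ x1)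
    have h1 : (e1 - ∑ i, a i • g i) x1 = 1 - (∑ i, a i • g i) x1 := by
      rw [Pi.sub_apply, he1x1]
    rw [h1]
    have h2 : 1 / 2 ≤ ‖(1 : ℂ) - (∑ i, a i • g i) x1‖ := by
      have := norm_sub_norm_le (1 : ℂ) ((∑ i, a i • g i) x1)
      rw [norm_one] at this
      linarith
    exact pow_le_pow_left₀ (by norm_num) h2 2
  linarith

end Summit.QuantumAdvantage.QuantumAdvantage.Theorems.GaussRankPolyImpliesPPoly.Negative
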